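import Summits.Ventures.PercRepro.ExcessOneDownSetSetup
import Summits.Ventures.PercRepro.ExcessOneTraceReduction

/-!
# The one-sided trace reduction: a block-type near-member side made of member singletons forces
(TR-r), hence the block form of Conjecture V

Setting of `ExcessOneDownSet` (proofs/MINE1-theoremS.md, Addendum 28): `F` has Marica–Schönheim
excess one, `{r} ∈ F`, `∅ ∉ F`, the trace `P = proj r F` is tight and contains every singleton, and
the labelling is *monotone on the lifted side*: `F₁ = partr r F` is a down-set of `P`. Then the
type-I differences `Y = diffsY r F` are exactly the **free** faces of `F₁` — those disjoint from
some member of `F₀ = part0 r F` (`diffsY_subset_partr_of_downSet`, `mem_diffsY_of_disjoint`).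

**Theorem (one-sided (RM)).** If some set `W ∉ F₁` has all its singletons in `F₀`, then every face
of `F₁` is free (a nonfree face would contain `W`), so `|F₁| = |Y| = |K| + 1` and
`F₁ = K ∪ {∅}`: every member containing `r` is `{r}` or keeps being a member after removing `r`
(`partr_subset_insert_empty_of_sided`). With Lemma R (`diffs_eq_insert_empty_of_trace`) this is the
block form of Conjecture V at `r`: `F \\ F = insert ∅ F` (`diffs_eq_insert_empty_of_sided`).

For a residue instance with near-member `u ∋ r`, `W = ū` (all singletons of the complement of `u`
are members) or `W = u ∖ {r}` (all singletons of `u` other than `r` are members) are the two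
one-sided cases of Addendum 28 (R3); the remaining case of (RM) has `r`-only singletons on both
sides.
-/

namespace PercRepro.MSTight

open Finset
open scoped FinsetFamily

variable {α : Type*} [DecidableEq α] [Fintype α]

section Sided

variable {F : Finset (Finset α)} {r : α}

/-- When `F₁` is a down-set of the trace, every type-I difference is `r`-lifted. -/
theorem diffsY_subset_partr_of_downSet (hP : Tight (proj r F)) (hr : ({r} : Finset α) ∈ F)
    (hsing : ∀ a, a ≠ r → ({a} : Finset α) ∈ proj r F)
    (hdown : ∀ t ∈ partr r F, ∀ e ∈ proj r F, e ⊆ t → e ∈ partr r F) :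
    diffsY r F ⊆ partr r F := by
  intro y hy
  obtain ⟨t, ht, s, _, rfl⟩ := Finset.mem_diffs.1 hy
  have htP : t ∈ proj r F := by rw [proj_eq_union]; exact mem_union_right _ ht
  exact hdown t ht (t \ s) (mem_proj_of_subset hP hr hsing htP sdiff_subset) sdiff_subset

omit [Fintype α] in
/-- An `r`-lifted face disjoint from a member avoiding `r` is a type-I difference. -/
theorem mem_diffsY_of_disjoint {t : Finset α} (ht : t ∈ partr r F) {s : Finset α}
    (hs : s ∈ part0 r F) (hd : Disjoint t s) : t ∈ diffsY r F := by
  have h := sdiff_mem_diffs ht hs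
  rwa [sdiff_eq_self_of_disjoint hd] at h

/-- **The one-sided trace reduction (TR-r).** If `F₁` is a down-set of the tight trace and some
set `W` that is not `r`-lifted has all its singletons in `F₀`, then every `r`-lifted face is free,
`Y = F₁`, and `F₁ = K ∪ {∅}`: every member containing `r` is `{r}` or stays a member after
removing `r`. -/
theorem partr_subset_insert_empty_of_sided (hF : (F \\ F).card = F.card + 1)
    (hP : Tight (proj r F)) (hr : ({r} : Finset α) ∈ F) (hE : (∅ : Finset α) ∉ F)
    (hsing : ∀ a, a ≠ r → ({a} : Finset α) ∈ proj r F)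
    (hdown : ∀ t ∈ partr r F, ∀ e ∈ proj r F, e ⊆ t → e ∈ partr r F)
    {W : Finset α} (hW1 : W ∉ partr r F) (hWs : ∀ z ∈ W, ({z} : Finset α) ∈ part0 r F) :
    partr r F ⊆ insert ∅ (part0 r F) := by
  -- every `r`-lifted face is free
  have hfree : ∀ t ∈ partr r F, ∃ s ∈ part0 r F, Disjoint t s := by
    intro t ht
    by_contra hcon
    simp only [not_exists, not_and] at hcon
    have hWt : W ⊆ t := by
      intro z hz
      have h := hcon {z} (hWs z hz)
      rw [Finset.disjoint_singleton_right] at h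
      exact not_not.1 h
    have htP : t ∈ proj r F := by rw [proj_eq_union]; exact mem_union_right _ ht
    exact hW1 (hdown t ht W (mem_proj_of_subset hP hr hsing htP hWt) hWt)
  have hY : diffsY r F = partr r F := by
    apply Subset.antisymm (diffsY_subset_partr_of_downSet hP hr hsing hdown)
    intro t ht
    obtain ⟨s, hs, hd⟩ := hfree t ht
    exact mem_diffsY_of_disjoint ht hs hd
  -- the count: `|F₁| = |Y| = |K| + 1 = |K ∪ {∅}|`
  have hcard : (partr r F).card = (partner r F).card + 1 := by
    rw [← hY]; exact card_diffsY_of_singleton_mem hP hr hF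
  have hsub : insert ∅ (partner r F) ⊆ partr r F := by
    apply insert_subset
    · exact mem_partr.2 ⟨notMem_empty r, by simpa using hr⟩
    · exact inter_subset_right
  have h0 : (∅ : Finset α) ∉ partner r F := fun h => hE (mem_part0.1 (mem_inter.1 h).1).1
  have hcard2 : (insert ∅ (partner r F)).card = (partner r F).card + 1 :=
    card_insert_of_notMem h0
  have heq : insert ∅ (partner r F) = partr r F := eq_of_subset_of_card_le hsub (by omega)
  rw [← heq]
  exact insert_subset_insert _ inter_subset_left

/-- **The block form of Conjecture V at `r` from a one-sided near-member.** Under the hypotheses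
of `partr_subset_insert_empty_of_sided`, with `univ ∉ F` and full support, `F \\ F = insert ∅ F`
(Lemma R). -/
theorem diffs_eq_insert_empty_of_sided (hF : (F \\ F).card = F.card + 1)
    (hP : Tight (proj r F)) (hr : ({r} : Finset α) ∈ F) (hE : (∅ : Finset α) ∉ F)
    (hsing : ∀ a, a ≠ r → ({a} : Finset α) ∈ proj r F)
    (hdown : ∀ t ∈ partr r F, ∀ e ∈ proj r F, e ⊆ t → e ∈ partr r F)
    {W : Finset α} (hW1 : W ∉ partr r F) (hWs : ∀ z ∈ W, ({z} : Finset α) ∈ part0 r F)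
    (hU : (Finset.univ : Finset α) ∉ F) (hcov : ∀ x : α, ∃ t ∈ F, x ∈ t) :
    F \\ F = insert ∅ F := by
  have htr := partr_subset_insert_empty_of_sided hF hP hr hE hsing hdown hW1 hWs
  refine diffs_eq_insert_empty_of_trace hr ?_ hP hU hcov hF hE
  intro t ht hrt
  have h1 : t.erase r ∈ partr r F :=
    mem_partr.2 ⟨notMem_erase r t, by rw [insert_erase hrt]; exact ht⟩
  have h2 := htr h1
  rw [mem_insert] at h2
  rcases h2 with h2 | h2
  · right
    rw [← insert_erase hrt, h2]
    rfl
  · left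
    exact (mem_part0.1 h2).1

/-- **The facet lemma.** A free `r`-only facet `f` of the trace (no face strictly above `f`, `f`
not a member avoiding `r`, `f` disjoint from some member `s` avoiding `r`) is impossible when some
member avoiding `r` has its `r`-partner: removing the member `insert r f` loses exactly the two
differences `f` and `insert r f`, so the rest is TIGHT and Lemma B makes it closed under adding
`r` — every member avoiding `r` has its `r`-partner. -/
theorem part0_subset_partr_of_free_facet (hF : (F \\ F).card = F.card + 1)
    (hr : ({r} : Finset α) ∈ F) (hE : (∅ : Finset α) ∉ F)
    {f : Finset α} (hf1 : f ∈ partr r F) (hf0 : f ∉ part0 r F)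
    (hmax : ∀ e ∈ proj r F, f ⊆ e → e = f)
    {s : Finset α} (hs : s ∈ part0 r F) (hfs : Disjoint f s)
    {k : Finset α} (hk : k ∈ partner r F) :
    part0 r F ⊆ partr r F := by
  have hrf : r ∉ f := (mem_partr.1 hf1).1
  have hmem : insert r f ∈ F := (mem_partr.1 hf1).2
  have hfne : f ≠ ∅ := by
    rintro rfl
    have hsP : s ∈ proj r F := by rw [proj_eq_union]; exact mem_union_left _ hs
    have := hmax s hsP (empty_subset s)
    rw [this] at hs
    exact hE (mem_part0.1 hs).1
  set F' := F.erase (insert r f) with hF'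
  -- the two lost differences
  have hfD : f ∈ F \\ F := by
    have h := sdiff_mem_diffs hmem hr
    rwa [insert_sdiff_of_mem f (mem_singleton_self r), sdiff_singleton_eq_erase,
      erase_eq_of_notMem hrf] at h
  have hrfD : insert r f ∈ F \\ F := by
    have h := sdiff_mem_diffs hmem (mem_part0.1 hs).1
    rwa [sdiff_eq_self_of_disjoint] at h
    rw [Finset.disjoint_insert_left]
    exact ⟨(mem_part0.1 hs).2, hfs⟩
  have hne : f ≠ insert r f := fun h => hrf (h ▸ mem_insert_self r f)
  have hsub : F' \\ F' ⊆ ((F \\ F).erase f).erase (insert r f) := by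
    intro E hE'
    obtain ⟨A, hA, B, hB, rfl⟩ := Finset.mem_diffs.1 hE'
    have hA' := mem_erase.1 hA
    have hB' := mem_erase.1 hB
    rw [mem_erase, mem_erase]
    refine ⟨?_, ?_, sdiff_mem_diffs hA'.2 hB'.2⟩
    · -- `A \ B ≠ insert r f`
      intro h
      have hrA : r ∈ A := (mem_sdiff.1 (h ▸ mem_insert_self r f)).1
      have hA1 : A.erase r ∈ proj r F := mem_proj.2 ⟨A, hA'.2, rfl⟩
      have hfA : f ⊆ A.erase r := by
        intro a ha
        have : a ∈ A \ B := by rw [h]; exact mem_insert_of_mem ha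
        exact mem_erase.2 ⟨fun hr' => hrf (hr' ▸ ha), (mem_sdiff.1 this).1⟩
      have := hmax _ hA1 hfA
      apply hA'.1
      rw [← insert_erase hrA, this]
    · -- `A \ B ≠ f`
      intro h
      by_cases hrA : r ∈ A
      · have hA1 : A.erase r ∈ proj r F := mem_proj.2 ⟨A, hA'.2, rfl⟩
        have hfA : f ⊆ A.erase r := by
          intro a ha
          have : a ∈ A \ B := by rw [h]; exact ha
          exact mem_erase.2 ⟨fun hr' => hrf (hr' ▸ ha), (mem_sdiff.1 this).1⟩
        have := hmax _ hA1 hfA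
        apply hA'.1
        rw [← insert_erase hrA, this]
      · have hA0 : A ∈ proj r F := by
          rw [proj_eq_union]; exact mem_union_left _ (mem_part0.2 ⟨hA'.2, hrA⟩)
        have hfA : f ⊆ A := by
          intro a ha
          have : a ∈ A \ B := by rw [h]; exact ha
          exact (mem_sdiff.1 this).1
        have := hmax A hA0 hfA
        exact hf0 (this ▸ mem_part0.2 ⟨hA'.2, hrA⟩)
  -- `F'` is tight
  have hcardF' : F'.card = F.card - 1 := card_erase_of_mem hmem
  have hc1 : (((F \\ F).erase f).erase (insert r f)).card = (F \\ F).card - 2 := by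
    have hm : insert r f ∈ (F \\ F).erase f := mem_erase.2 ⟨hne.symm, hrfD⟩
    rw [card_erase_of_mem hm, card_erase_of_mem hfD]
    omega
  have hT : Tight F' := by
    have h1 := card_le_card hsub
    have h2 := Finset.card_le_card_diffs F'
    have h3 : 1 ≤ F.card := card_pos.2 ⟨_, hmem⟩
    unfold Tight
    omega
  -- `{r} ∈ F'` and the partner family of `F'` at `r` is nonempty
  have hrF' : ({r} : Finset α) ∈ F' := by
    rw [hF', mem_erase]
    refine ⟨fun h => ?_, hr⟩
    have : f = ({r} : Finset α).erase r := by rw [h, erase_insert hrf]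
    rw [erase_singleton] at this
    exact hfne this
  have hkK : k ∈ partner r F' := by
    have hk0 := mem_part0.1 (mem_inter.1 hk).1
    have hk1 := mem_partr.1 (mem_inter.1 hk).2
    refine mem_inter.2 ⟨mem_part0.2 ⟨?_, hk0.2⟩, mem_partr.2 ⟨hk0.2, ?_⟩⟩
    · rw [hF', mem_erase]
      exact ⟨fun h => hk0.2 (h ▸ mem_insert_self r f), hk0.1⟩
    · rw [hF', mem_erase]
      refine ⟨fun h => hf0 ?_, hk1.2⟩
      have : k = f := by
        rw [← erase_insert hk0.2, h, erase_insert hrf]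
      rw [← this]
      exact mem_part0.2 ⟨hk0.1, hk0.2⟩
  have hdich := dichotomy_of_tight (tight_proj_and_partner (r := r) hT).2.1
  rcases addable_or_deletable_of_partner_nonempty hT ⟨k, hkK⟩ hdich with hadd | hdel
  · intro p hp
    have hp0 := mem_part0.1 hp
    have hpF' : p ∈ F' := by
      rw [hF', mem_erase]
      exact ⟨fun h => hp0.2 (h ▸ mem_insert_self r f), hp0.1⟩
    have := hadd p hpF' hp0.2
    exact mem_partr.2 ⟨hp0.2, mem_of_mem_erase this⟩
  · exfalso
    have h := hdel {r} hrF' (mem_singleton_self r)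
    rw [erase_singleton] at h
    exact hE (mem_of_mem_erase h)

end Sided

end PercRepro.MSTight
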